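import Mathlib.Analysis.Asymptotics.Lemmas
import Literature.Computability.AlgebraicComplexity.AlmanLi2026CwPrimeTensor
import Literature.Computability.AlgebraicComplexity.BorderRankRestriction
import Literature.Computability.AlgebraicComplexity.AsymptoticRankLimit
import Literature.Computability.AlgebraicComplexity.CwEasyOmegaBound
import Literature.Barriers.MatrixMultiplication.UniversalMethodBarrierAsymptoticRank
import HarnessLib

/-!
# `cw'_2` versus `cw_2`: the two small Coppersmith–Winograd tensors are isomorphic over `ℂ`, and "`R̃(cw'_2) = 3 ⇒ ω = 2`"

Topic `Literature/Computability/AlgebraicComplexity` (family `MatrixMultiplication`). PROVED, no named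
facts, no definitions.

Alman–Li 2026, §7.1 (display before Cor. 7.2; held `paper:arxiv-2605.21738` p0017 L126–134): "the
following variant of the `cw_2` tensor, which first appears in [CW90], is equally useful from the
perspective of the laser method: `cw'_2 ≔ x₁y₂z₃ + x₁y₃z₂ + x₂y₁z₃ + x₂y₃z₁ + x₃y₁z₂ + x₃y₂z₁`. In
particular, if one could prove `R̃(cw'_2) = 3`, then it would follow that `ω = 2`."  Coppersmith–Winograd
1990, §11 (p. 277): "If the trilinear form `x₀y₁z₂ + x₀y₂z₁ + x₁y₀z₂ + x₂y₀z₁ + x₁y₂z₀ + x₂y₁z₀` had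
border rank 3, then by the techniques of Chapter 6 (easy case) with `q = 2`, we could prove `ω = 2`."
For the little Coppersmith–Winograd tensor `T_cw,2 = cw_2` itself this is Conner–Gesmundo–Landsberg–
Ventura 2022, p. 3: "were `R̃(T_cw,2) = 3`, then Theorem 1.1 would imply `ω = 2`" — PROVED in the tree as
`CoppersmithWinograd1990_asymptoticRank_form_holds` (growth form) / `omega_le_logb_cw_easy`.

This file transfers the statement from `cw_2` to `cw'_2` by an explicit isomorphism (the device of this
formalisation; the sources give no proof): over a field with an element `i`, `i² = −1`, and `2 ≠ 0`, the
substitution `X₀ = x₀/2, X₁ = x₁ + i x₂, X₂ = x₁ − i x₂` (in all three factors) carries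
`cw'_2(X,Y,Z)` to `cw_2(x,y,z)`: `X₁Z₂ + X₂Z₁ = 2(x₁z₁ + x₂z₂)` etc.  (As cubic forms: `x₀(x₁² + x₂²) =
x₀(x₁ + ix₂)(x₁ − ix₂)`.)

* `tensorRestrictsTo_cwPrimeTensor_cwTensor_two`, `tensorRestrictsTo_cwTensor_two_cwPrimeTensor` —
  `cw'_2 ≥ cw_2` and `cw_2 ≥ cw'_2` (restriction both ways) over such fields;
* `tensorRank_cwPrimeTensor_eq`, `algBorderRank_cwPrimeTensor_eq`, `asymptoticRank_cwPrimeTensor_eq` —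
  hence equal rank, border rank and asymptotic rank; over `ℂ`: `asymptoticRank_cwPrimeTensor_complex`;
* `isBigO_tensorRank_kroneckerPow_of_asymptoticRank_le` — `R̃(t) ≤ c` (`c > 1`) gives
  `R(t^{⊗N}) = O(c^{(1+ε)N})` for every `ε > 0` (from the limit form `R(t^{⊗n})^{1/n} → R̃(t)`,
  `advxxz2025_asymptoticRank_tendsto`) — the hypothesis format of
  `CoppersmithWinograd1990_asymptoticRank_form`;
* `omega_eq_two_of_asymptoticRank_cwTensor_two_le` — **CGLV p. 3**: `R̃(cw_2) ≤ 3 ⇒ ω(ℂ) = 2`;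
* `omega_eq_two_of_asymptoticRank_cwPrimeTensor_le` — **Alman–Li §7.1 / CW90 §11**:
  `R̃(cw'_2) ≤ 3 ⇒ ω(ℂ) = 2`.

(`R̲(cw'_2) = 4`, so the border-rank route of CW90 is closed: `CwPrimeTensorBorderRank.lean`; the
asymptotic-rank route is open in print — Alman–Li Cor. 7.2: `R̃(cw'_2) < 3.931`, tree
`AlmanLi2026.asymptoticRank_cwPrimeTensor_lt`.)

## References

* J. Alman, B. Li, *Asymptotic Rank Speedup Theorems, Revisited*, arXiv:2605.21738 (2026) = CCC 2026
  (LIPIcs 383:36), §7.1 (display before Cor. 7.2). [AlmanLi2026]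
* D. Coppersmith, S. Winograd, *Matrix multiplication via arithmetic progressions*, J. Symbolic
  Comput. 9 (1990) 251–280, §11, p. 277; §6. [CoppersmithWinograd1990]
* A. Conner, F. Gesmundo, J. M. Landsberg, E. Ventura, *Rank and border rank of Kronecker powers of
  tensors and Strassen's laser method*, comput. complexity 31 (2022), Thm. 1.1 and p. 3.
  [ConnerGesmundoLandsbergVentura2022]
* J. Alman, R. Duan, V. Vassilevska Williams, Y. Xu, Z. Xu, R. Zhou, *More asymmetry yields faster
  matrix multiplication*, SODA 2025, §3.2 (`R̃` as a limit). [AlmanDuanVassilevskaWilliamsXuXuZhou2025]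
-/

noncomputable section

open scoped BigOperators
open Filter Asymptotics

namespace Literature.Computability.AlgebraicComplexity

open Literature.Barriers.MatrixMultiplication (asymptoticRank_le_of_polyDegeneratesTo)

universe u

/-! ## The explicit isomorphism `cw'_2 ≅ cw_2` over fields with `√-1` and `2 ≠ 0` -/

section Iso

variable (K : Type u) [Field K]

/-- **`cw'_2 ≥ cw_2`**: with `i² = −1`, `2 ≠ 0`, the substitution `X₀ = x₀/2`, `X₁ = x₁ + i x₂`,
`X₂ = x₁ − i x₂` in each of the three factors turns `cw'_2(X,Y,Z)` into `cw_2(x,y,z)` (matrix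
`M = [[1/2,0,0],[0,1,1],[0,i,−i]]`, rows = variables of `cw_2`). [cite: AlmanLi2026, §7.1 (display before Cor. 7.2: "variant of the cw_2 tensor")] -/
theorem tensorRestrictsTo_cwPrimeTensor_cwTensor_two {i : K} (hi : i * i = -1) (h2 : (2 : K) ≠ 0) :
    TensorRestrictsTo (cwPrimeTensor K) (cwTensor K 2) := by
  have hi2 : i ^ 2 = -1 := by rw [sq, hi]
  let M : Fin 3 → Fin 3 → K := fun a' a => !![(2 : K)⁻¹, 0, 0; 0, 1, 1; 0, i, -i] a' a
  refine ⟨M, M, M, fun a' b' c' => ?_⟩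
  fin_cases a' <;> fin_cases b' <;> fin_cases c' <;>
    simp [M, Fin.sum_univ_three, cwPrimeTensor_apply, cwTensor_apply] <;>
    field_simp <;> ring_nf <;> simp [hi2]

/-- **`cw_2 ≥ cw'_2`**: the inverse substitution `x₀ = 2X₀`, `x₁ = (X₁ + X₂)/2`,
`x₂ = −i(X₁ − X₂)/2` (matrix `[[2,0,0],[0,1/2,−i/2],[0,1/2,i/2]]`, rows = variables of `cw'_2`).
[cite: AlmanLi2026, §7.1 (display before Cor. 7.2: "variant of the cw_2 tensor")] -/
theorem tensorRestrictsTo_cwTensor_two_cwPrimeTensor {i : K} (hi : i * i = -1) (h2 : (2 : K) ≠ 0) :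
    TensorRestrictsTo (cwTensor K 2) (cwPrimeTensor K) := by
  have hi2 : i ^ 2 = -1 := by rw [sq, hi]
  let N : Fin 3 → Fin 3 → K :=
    fun a' a => !![(2 : K), 0, 0; 0, 2⁻¹, -i * 2⁻¹; 0, 2⁻¹, i * 2⁻¹] a' a
  refine ⟨N, N, N, fun a' b' c' => ?_⟩
  fin_cases a' <;> fin_cases b' <;> fin_cases c' <;>
    simp [N, Fin.sum_univ_three, cwPrimeTensor_apply, cwTensor_apply] <;>
    field_simp <;> ring_nf <;> simp [hi2] <;> ring

/-- Equal rank: `R(cw'_2) = R(cw_2)` over fields with `i² = −1` and `2 ≠ 0`. [cite: AlmanLi2026, §7.1 (display before Cor. 7.2)] -/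
theorem tensorRank_cwPrimeTensor_eq {i : K} (hi : i * i = -1) (h2 : (2 : K) ≠ 0) :
    tensorRank (cwPrimeTensor K) = tensorRank (cwTensor K 2) :=
  le_antisymm (tensorRestrictsTo_cwTensor_two_cwPrimeTensor K hi h2).tensorRank_le
    (tensorRestrictsTo_cwPrimeTensor_cwTensor_two K hi h2).tensorRank_le

/-- Equal border rank: `R̲(cw'_2) = R̲(cw_2)` over fields with `i² = −1` and `2 ≠ 0` (both are `4`:
`CwPrimeTensorBorderRank.lean`, `BorderRankCW*.lean`). [cite: CoppersmithWinograd1990, §11 (p. 277)] -/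
theorem algBorderRank_cwPrimeTensor_eq {i : K} (hi : i * i = -1) (h2 : (2 : K) ≠ 0) :
    algBorderRank (cwPrimeTensor K) = algBorderRank (cwTensor K 2) :=
  le_antisymm (tensorRestrictsTo_cwTensor_two_cwPrimeTensor K hi h2).algBorderRank_le
    (tensorRestrictsTo_cwPrimeTensor_cwTensor_two K hi h2).algBorderRank_le

/-- Equal asymptotic rank: `R̃(cw'_2) = R̃(cw_2)` over fields with `i² = −1` and `2 ≠ 0`.
[cite: AlmanLi2026, §7.1 (display before Cor. 7.2)] -/
theorem asymptoticRank_cwPrimeTensor_eq {i : K} (hi : i * i = -1) (h2 : (2 : K) ≠ 0) :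
    asymptoticRank (cwPrimeTensor K) = asymptoticRank (cwTensor K 2) :=
  le_antisymm
    (asymptoticRank_le_of_polyDegeneratesTo
      (tensorRestrictsTo_cwTensor_two_cwPrimeTensor K hi h2).polyDegeneratesTo)
    (asymptoticRank_le_of_polyDegeneratesTo
      (tensorRestrictsTo_cwPrimeTensor_cwTensor_two K hi h2).polyDegeneratesTo)

end Iso

/-- Over `ℂ`: `R̃(cw'_2) = R̃(cw_2)` (`i = Complex.I`). [cite: AlmanLi2026, §7.1 (display before Cor. 7.2)] -/
theorem asymptoticRank_cwPrimeTensor_complex :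
    asymptoticRank (cwPrimeTensor ℂ) = asymptoticRank (cwTensor ℂ 2) :=
  asymptoticRank_cwPrimeTensor_eq ℂ Complex.I_mul_I (by norm_num)

/-! ## From `R̃(t) ≤ c` to the growth bound on Kronecker powers -/

section Growth

variable {K : Type u} [Field K] {ι κ μ : Type*} [Fintype ι] [Fintype κ] [Fintype μ]

/-- **`R̃(t) ≤ c` in growth form**: if `asymptoticRank t ≤ c` with `c > 1` then
`R(t^{⊗N}) = O(c^{(1+ε)N})` for every `ε > 0` — eventually `R(t^{⊗n})^{1/n} < c^{1+ε}` by the limit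
form `R(t^{⊗n})^{1/n} → R̃(t)` (ADVXXZ 2025 §3.2, tree `advxxz2025_asymptoticRank_tendsto`). This is
the hypothesis format of `CoppersmithWinograd1990_asymptoticRank_form`.
[cite: AlmanDuanVassilevskaWilliamsXuXuZhou2025, §3.2] -/
theorem isBigO_tensorRank_kroneckerPow_of_asymptoticRank_le (t : ι → κ → μ → K) {c : ℝ}
    (hc : 1 < c) (h : asymptoticRank t ≤ c) {ε : ℝ} (hε : 0 < ε) :
    (fun N : ℕ => (tensorRank (kroneckerPow t N) : ℝ)) =O[atTop]
      fun N : ℕ => c ^ ((1 + ε) * N) := by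
  have hc0 : 0 < c := by linarith
  -- `B = c^{1+ε} > c ≥ R̃(t)`
  set B : ℝ := c ^ (1 + ε) with hB
  have hcB : c < B := by
    rw [hB]
    conv_lhs => rw [← Real.rpow_one c]
    exact Real.rpow_lt_rpow_of_exponent_lt hc (by linarith)
  have hlt : asymptoticRank t < B := lt_of_le_of_lt h hcB
  have hev := (advxxz2025_asymptoticRank_tendsto t).eventually (gt_mem_nhds hlt)
  obtain ⟨n₀, hn₀⟩ := eventually_atTop.1 hev
  refine IsBigO.of_bound 1 ?_
  filter_upwards [eventually_ge_atTop (n₀ + 1)] with N hN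
  rw [Real.norm_of_nonneg (Nat.cast_nonneg _), Real.norm_of_nonneg (Real.rpow_pos_of_pos hc0 _).le,
    one_mul]
  have hN0 : N ≠ 0 := by omega
  have h1 := hn₀ N (by omega)
  have hR0 : (0 : ℝ) ≤ tensorRank (kroneckerPow t N) := Nat.cast_nonneg _
  have h2 := pow_lt_pow_left₀ h1 (Real.rpow_nonneg hR0 _) hN0
  rw [Real.rpow_inv_natCast_pow hR0 hN0] at h2
  have h3 : B ^ N = c ^ ((1 + ε) * N) := by
    rw [hB, ← Real.rpow_mul_natCast hc0.le]
  rw [← h3]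
  exact h2.le

end Growth

/-! ## `R̃(cw_2) = 3 ⇒ ω = 2` and `R̃(cw'_2) = 3 ⇒ ω = 2` -/

/-- **CGLV 2022, p. 3** ("were `R̃(T_cw,2) = 3`, then Theorem 1.1 would imply `ω = 2`"), with the
tree's PROVED laser-method theorem `CoppersmithWinograd1990_asymptoticRank_form_holds`:
`R̃(cw_2) ≤ 3 ⇒ ω(ℂ) = 2` (`ω ≥ 2` being the flattening bound).
[cite: ConnerGesmundoLandsbergVentura2022, Thm 1.1 and p. 3] -/
theorem omega_eq_two_of_asymptoticRank_cwTensor_two_le (h : asymptoticRank (cwTensor ℂ 2) ≤ 3) :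
    omega ℂ = 2 := by
  refine le_antisymm ?_ (omega_two_le ℂ)
  have hω := CoppersmithWinograd1990_asymptoticRank_form_holds 2 le_rfl 3 (by norm_num)
    (fun ε hε => isBigO_tensorRank_kroneckerPow_of_asymptoticRank_le (cwTensor ℂ 2)
      (by norm_num) h hε)
  rwa [Nat.cast_ofNat, logb_two_cw_two] at hω

/-- **Alman–Li 2026, §7.1 / Coppersmith–Winograd 1990, §11**: "if one could prove `R̃(cw'_2) = 3`,
then it would follow that `ω = 2`" — over `ℂ`: `R̃(cw'_2) ≤ 3 ⇒ ω(ℂ) = 2` (via `cw'_2 ≅ cw_2` over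
`ℂ` and the `cw_2` statement). [cite: AlmanLi2026, §7.1 (display before Cor. 7.2)] [cite: CoppersmithWinograd1990, §11 (p. 277)] -/
theorem omega_eq_two_of_asymptoticRank_cwPrimeTensor_le (h : asymptoticRank (cwPrimeTensor ℂ) ≤ 3) :
    omega ℂ = 2 :=
  omega_eq_two_of_asymptoticRank_cwTensor_two_le (asymptoticRank_cwPrimeTensor_complex ▸ h)

/-- The same in the tree's summit vocabulary: `R̃(cw'_2) ≤ 3 ⇒ MatrixMultiplication` (`ω(ℂ) = 2`).
[cite: AlmanLi2026, §7.1 (display before Cor. 7.2)] -/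
theorem matrixMultiplication_of_asymptoticRank_cwPrimeTensor_le
    (h : asymptoticRank (cwPrimeTensor ℂ) ≤ 3) : MatrixMultiplication :=
  omega_eq_two_of_asymptoticRank_cwPrimeTensor_le h

end Literature.Computability.AlgebraicComplexity

end
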